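import Summits.CriticalPhenomena.PercolationContinuityZ3.Theorems.PercNearOneGluingNoHeavyLowerTailBlockQ9TwoDangerousPiece
import HarnessLib

/-!
# `NoHeavyLowerTail` (stmt-CriticalPhenomena-4575) — the TIE EDGE: existence of the θ for which BOTH anchored
# two-pair components are valid (the boundary datum of every certificate for Kozma–Nitzan's Question 9 on a block)

Support file (hull-port / coupling seat `prim-hp-1` gen 12; `--supports stmt-CriticalPhenomena-4575`).
No definitions, no named facts, no sorries.  Memo `run/shared/lean/prim/prim-hp-1/HULLPORT-COUPLING.md` §50(d), §52.

Setting: ANY weights `w` on `Fin n` (e.g. the unglued split graph of a depth-two observer), a vertex `a`, a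
target `b`, two distinct non-loop pairs `e₁ = s(p₁,s₁)`, `e₂ = s(p₂,s₂)` of weights `ρ₁, ρ₂ ∈ (0,1)`, and the
domination hypotheses `μ_w(a ↔ b) ≤ μ_w(p_i ↔ b)` (`i = 1,2`).

* `BlockQ9.exists_theta_anchored` — there is `θ ∈ [0,1]` such that `a` is dominated by `p₁` in the ANCHORED
  graph `w[e₁ ↦ 1, e₂ ↦ r₂]` with `odds(r₂) = θ · odds(ρ₂)` (`r₂ = ρ₂θ/(1 − ρ₂ + ρ₂θ)`) AND by `p₂` in
  `w[e₂ ↦ 1, e₁ ↦ r₁]` with `odds(r₁) = (1 − θ) · odds(ρ₁)`.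

This is the analytic core of `BlockQ9.blockQ9_twoDangerous` (there inlined), isolated because it is exactly the
datum carried by each of the three "tie edges" of the hexagon of transitive tournaments in the three-pair problem
(memo §52): the two anchored validities are the `t = 0` end of the pointwise-dichotomy path and the edge data of the
KKM formulation.  Proof: with `α_i` = advantage of `a` over `p_i` on the cell "only `e_i` open" and `β_i` = advantage
of `p_i` on "both open", Lemma 3(i) (`SeqExchange.lemma3i_pair`) gives `α_i ≤ β_i`, the two-edge sequential lemma
(`SeqExchange.seq_two`, both orders) gives `α₁ + α₂ ≤ β_i`, `BlockQ9.exists_theta` picks `θ` with `α₁ ≤ θβ₁`,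
`α₂ ≤ (1−θ)β₂`, and the one-bond decomposition along the re-weighted pair turns these into the two validities.
[cite: KozmaNitzan2024, Lemma 3(i) (pp. 6–7), Lemma 5 (p. 13)]
-/

namespace Summit.CriticalPhenomena.PercolationContinuityZ3.Theorems

open MeasureTheory Set
open Literature.Probability.LatticeModels
open Literature.Probability.Percolation

noncomputable section
open Classical

namespace BlockQ9

variable {n : ℕ}

/-- **The tie edge.**  Two distinct non-loop pairs `e_i = s(p_i, s_i)` with weights in `(0,1)`, `a` dominated by
`p₁` and by `p₂` in `w`.  Then for some `θ ∈ [0,1]`: for every `r₂` with `r₂ = ρ₂θ/(1−ρ₂+ρ₂θ)` the anchored graph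
`w[e₁ ↦ 1][e₂ ↦ r₂]` has `μ(a ↔ b) ≤ μ(p₁ ↔ b)`, and for every `r₁` with `r₁ = ρ₁(1−θ)/(1−ρ₁+ρ₁(1−θ))` the
anchored graph `w[e₂ ↦ 1][e₁ ↦ r₁]` has `μ(a ↔ b) ≤ μ(p₂ ↔ b)` (`ρ_i = w e_i`).
[cite: KozmaNitzan2024, Lemma 3(i) (pp. 6–7), Lemma 5 (p. 13); this work (memo §50(d))] -/
theorem exists_theta_anchored (w : Sym2 (Fin n) → unitInterval) (a b p₁ s₁ p₂ s₂ : Fin n)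
    (hps₁ : p₁ ≠ s₁) (hps₂ : p₂ ≠ s₂) (hne : s(p₁, s₁) ≠ s(p₂, s₂))
    (hpos₁ : 0 < (w s(p₁, s₁) : ℝ)) (hpos₂ : 0 < (w s(p₂, s₂) : ℝ))
    (hlt₁ : (w s(p₁, s₁) : ℝ) < 1) (hlt₂ : (w s(p₂, s₂) : ℝ) < 1)
    (hyp₁ : (prodBernoulli w).real (openConn a b) ≤ (prodBernoulli w).real (openConn p₁ b))
    (hyp₂ : (prodBernoulli w).real (openConn a b) ≤ (prodBernoulli w).real (openConn p₂ b)) :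
    ∃ θ : ℝ, 0 ≤ θ ∧ θ ≤ 1 ∧
      (∀ r₂ : unitInterval, (r₂ : ℝ) = (w s(p₂, s₂) : ℝ) * θ / (1 - (w s(p₂, s₂) : ℝ) + (w s(p₂, s₂) : ℝ) * θ) →
        (prodBernoulli (Function.update (Function.update w s(p₁, s₁) 1) s(p₂, s₂) r₂)).real (openConn a b) ≤
          (prodBernoulli (Function.update (Function.update w s(p₁, s₁) 1) s(p₂, s₂) r₂)).real (openConn p₁ b)) ∧
      (∀ r₁ : unitInterval, (r₁ : ℝ) =
          (w s(p₁, s₁) : ℝ) * (1 - θ) / (1 - (w s(p₁, s₁) : ℝ) + (w s(p₁, s₁) : ℝ) * (1 - θ)) →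
        (prodBernoulli (Function.update (Function.update w s(p₂, s₂) 1) s(p₁, s₁) r₁)).real (openConn a b) ≤
          (prodBernoulli (Function.update (Function.update w s(p₂, s₂) 1) s(p₁, s₁) r₁)).real (openConn p₂ b)) := by
  have hne' : s(p₂, s₂) ≠ s(p₁, s₁) := fun h => hne h.symm
  obtain ⟨e₁, he₁⟩ : ∃ e : Sym2 (Fin n), e = s(p₁, s₁) := ⟨_, rfl⟩
  obtain ⟨e₂, he₂⟩ : ∃ e : Sym2 (Fin n), e = s(p₂, s₂) := ⟨_, rfl⟩
  rw [← he₁] at hne hne' hpos₁ hlt₁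
  rw [← he₂] at hne hne' hpos₂ hlt₂
  rw [← he₁, ← he₂]
  obtain ⟨ρ₁, hρ₁⟩ : ∃ t : ℝ, t = (w e₁ : ℝ) := ⟨_, rfl⟩
  obtain ⟨ρ₂, hρ₂⟩ : ∃ t : ℝ, t = (w e₂ : ℝ) := ⟨_, rfl⟩
  rw [← hρ₁] at hpos₁ hlt₁
  rw [← hρ₂] at hpos₂ hlt₂
  rw [← hρ₁, ← hρ₂]
  have hW₂ : ∀ s : unitInterval, ((Function.update w e₁ s) e₂ : ℝ) = ρ₂ := fun s => by
    rw [Function.update_of_ne hne', hρ₂]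
  -- one-bond decompositions of the events `e₁ open`, `e₂ open`, `e₁ closed ∧ e₂ open`, `e₂ closed ∧ e₁ open`
  have dW_e₁ : ∀ Y : Set (BondConfig (Fin n)), (prodBernoulli w).real (Y ∩ {ω | s(p₁, s₁) ∈ ω}) =
      ρ₁ * ((1 - ρ₂) * (prodBernoulli (Function.update (Function.update w e₁ 1) e₂ 0)).real Y +
        ρ₂ * (prodBernoulli (Function.update (Function.update w e₁ 1) e₂ 1)).real Y) := by
    intro Y
    rw [← he₁, goodStepEI_real_inter_open_eq w e₁ Y, stub_oneBondDecomp_k15 n (Function.update w e₁ 1) e₂ Y,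
      hW₂, ← hρ₁]
  have dW_e₂ : ∀ Y : Set (BondConfig (Fin n)), (prodBernoulli w).real (Y ∩ {ω | s(p₂, s₂) ∈ ω}) =
      ρ₂ * ((1 - ρ₁) * (prodBernoulli (Function.update (Function.update w e₁ 0) e₂ 1)).real Y +
        ρ₁ * (prodBernoulli (Function.update (Function.update w e₁ 1) e₂ 1)).real Y) := by
    intro Y
    rw [← he₂, goodStepEI_real_inter_open_eq w e₂ Y, stub_oneBondDecomp_k15 n (Function.update w e₂ 1) e₁ Y,
      Function.update_of_ne hne, Function.update_comm hne', Function.update_comm hne', ← hρ₁, ← hρ₂]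
  have dW_ne₁e₂ : ∀ Y : Set (BondConfig (Fin n)),
      (prodBernoulli w).real (Y ∩ {ω | s(p₁, s₁) ∉ ω} ∩ {ω | s(p₂, s₂) ∈ ω}) =
        (1 - ρ₁) * (ρ₂ * (prodBernoulli (Function.update (Function.update w e₁ 0) e₂ 1)).real Y) := by
    intro Y
    rw [← he₁, ← he₂, Set.inter_right_comm, goodStepEI_real_inter_closed_eq w e₁ _,
      goodStepEI_real_inter_open_eq (Function.update w e₁ 0) e₂ Y, hW₂, ← hρ₁]
  have dW_ne₂e₁ : ∀ Y : Set (BondConfig (Fin n)),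
      (prodBernoulli w).real (Y ∩ {ω | s(p₂, s₂) ∉ ω} ∩ {ω | s(p₁, s₁) ∈ ω}) =
        (1 - ρ₂) * (ρ₁ * (prodBernoulli (Function.update (Function.update w e₁ 1) e₂ 0)).real Y) := by
    intro Y
    rw [← he₁, ← he₂, Set.inter_right_comm, goodStepEI_real_inter_closed_eq w e₂ _,
      goodStepEI_real_inter_open_eq (Function.update w e₂ 0) e₁ Y, Function.update_of_ne hne,
      Function.update_comm hne', ← hρ₁, ← hρ₂]
  -- cell quantities
  obtain ⟨X01, hX01⟩ : ∃ t : ℝ, t = (prodBernoulli (Function.update (Function.update w e₁ 0) e₂ 1)).real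
    (openConn a b) := ⟨_, rfl⟩
  obtain ⟨X10, hX10⟩ : ∃ t : ℝ, t = (prodBernoulli (Function.update (Function.update w e₁ 1) e₂ 0)).real
    (openConn a b) := ⟨_, rfl⟩
  obtain ⟨X11, hX11⟩ : ∃ t : ℝ, t = (prodBernoulli (Function.update (Function.update w e₁ 1) e₂ 1)).real
    (openConn a b) := ⟨_, rfl⟩
  obtain ⟨P0, hP0⟩ : ∃ t : ℝ, t = (prodBernoulli (Function.update (Function.update w e₁ 1) e₂ 0)).real
    (openConn p₁ b) := ⟨_, rfl⟩
  obtain ⟨P1, hP1⟩ : ∃ t : ℝ, t = (prodBernoulli (Function.update (Function.update w e₁ 1) e₂ 1)).real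
    (openConn p₁ b) := ⟨_, rfl⟩
  obtain ⟨Q0, hQ0⟩ : ∃ t : ℝ, t = (prodBernoulli (Function.update (Function.update w e₁ 0) e₂ 1)).real
    (openConn p₂ b) := ⟨_, rfl⟩
  obtain ⟨Q1, hQ1⟩ : ∃ t : ℝ, t = (prodBernoulli (Function.update (Function.update w e₁ 1) e₂ 1)).real
    (openConn p₂ b) := ⟨_, rfl⟩
  obtain ⟨α₁, hα₁⟩ : ∃ t : ℝ, t = ρ₁ * (1 - ρ₂) * (X10 - P0) := ⟨_, rfl⟩
  obtain ⟨β₁, hβ₁⟩ : ∃ t : ℝ, t = ρ₁ * ρ₂ * (P1 - X11) := ⟨_, rfl⟩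
  obtain ⟨α₂, hα₂⟩ : ∃ t : ℝ, t = (1 - ρ₁) * ρ₂ * (X01 - Q0) := ⟨_, rfl⟩
  obtain ⟨β₂, hβ₂⟩ : ∃ t : ℝ, t = ρ₁ * ρ₂ * (Q1 - X11) := ⟨_, rfl⟩
  -- Lemma 3(i) for each pair, and the sequential lemma in both orders
  have hyp₁' : (prodBernoulli w).real (openConn a b) ≤ (prodBernoulli w).real (openConn p₁ b) + 0 := by
    rw [add_zero]; exact hyp₁
  have hyp₂' : (prodBernoulli w).real (openConn a b) ≤ (prodBernoulli w).real (openConn p₂ b) + 0 := by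
    rw [add_zero]; exact hyp₂
  have L1 : α₁ ≤ β₁ := by
    have h := SeqExchange.lemma3i_pair w a p₁ s₁ b hps₁ le_rfl hyp₁'
    rw [zero_mul, add_zero, dW_e₁, dW_e₁] at h
    rw [← hX10, ← hX11, ← hP0, ← hP1] at h
    have : β₁ - α₁ = ρ₁ * ((1 - ρ₂) * P0 + ρ₂ * P1) - ρ₁ * ((1 - ρ₂) * X10 + ρ₂ * X11) := by
      rw [hα₁, hβ₁]; ring
    linarith
  have L2 : α₂ ≤ β₂ := by
    have h := SeqExchange.lemma3i_pair w a p₂ s₂ b hps₂ le_rfl hyp₂'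
    rw [zero_mul, add_zero, dW_e₂, dW_e₂] at h
    rw [← hX01, ← hX11, ← hQ0, ← hQ1] at h
    have : β₂ - α₂ = ρ₂ * ((1 - ρ₁) * Q0 + ρ₁ * Q1) - ρ₂ * ((1 - ρ₁) * X01 + ρ₁ * X11) := by
      rw [hα₂, hβ₂]; ring
    linarith
  have S12 : α₁ + α₂ ≤ β₁ := by
    have h := SeqExchange.seq_two w a p₁ s₁ p₂ s₂ b hps₁ hps₂ le_rfl hyp₁' hyp₂'
    rw [max_self, add_zero, dW_e₁, dW_e₁, dW_ne₁e₂, dW_ne₁e₂] at h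
    rw [← hX01, ← hX10, ← hX11, ← hP0, ← hP1, ← hQ0] at h
    have : β₁ - α₁ - α₂ = ρ₁ * ((1 - ρ₂) * P0 + ρ₂ * P1) + (1 - ρ₁) * (ρ₂ * Q0) -
        (ρ₁ * ((1 - ρ₂) * X10 + ρ₂ * X11) + (1 - ρ₁) * (ρ₂ * X01)) := by
      rw [hα₁, hβ₁, hα₂]; ring
    linarith
  have S21 : α₁ + α₂ ≤ β₂ := by
    have h := SeqExchange.seq_two w a p₂ s₂ p₁ s₁ b hps₂ hps₁ le_rfl hyp₂' hyp₁'
    rw [max_self, add_zero, dW_e₂, dW_e₂, dW_ne₂e₁, dW_ne₂e₁] at h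
    rw [← hX01, ← hX10, ← hX11, ← hP0, ← hQ0, ← hQ1] at h
    have : β₂ - α₁ - α₂ = ρ₂ * ((1 - ρ₁) * Q0 + ρ₁ * Q1) + (1 - ρ₂) * (ρ₁ * P0) -
        (ρ₂ * ((1 - ρ₁) * X01 + ρ₁ * X11) + (1 - ρ₂) * (ρ₁ * X10)) := by
      rw [hα₁, hβ₂, hα₂]; ring
    linarith
  -- the mixture parameter
  obtain ⟨θ, hθ0, hθ1, hA1, hA2⟩ := exists_theta L1 L2 S12 S21
  refine ⟨θ, hθ0, hθ1, ?_, ?_⟩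
  · -- anchor `p₁`: `e₁` forced open, `e₂` re-weighted to odds `θ·odds(ρ₂)`
    intro r₂ hr₂
    obtain ⟨D, hD⟩ : ∃ t : ℝ, t = 1 - ρ₂ + ρ₂ * θ := ⟨_, rfl⟩
    have hDpos : 0 < D := by rw [hD]; nlinarith
    have hrD : (r₂ : ℝ) * D = ρ₂ * θ := by
      rw [hr₂, ← hD]; field_simp
    have h1rD : (1 - (r₂ : ℝ)) * D = 1 - ρ₂ := by
      have : (1 - (r₂ : ℝ)) * D = D - (r₂ : ℝ) * D := by ring
      rw [this, hrD, hD]; ring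
    have da := stub_oneBondDecomp_k15 n (Function.update (Function.update w e₁ 1) e₂ r₂) e₂ (openConn a b)
    have dp := stub_oneBondDecomp_k15 n (Function.update (Function.update w e₁ 1) e₂ r₂) e₂ (openConn p₁ b)
    rw [Function.update_self, Function.update_idem, Function.update_idem] at da dp
    rw [← hX10, ← hX11] at da
    rw [← hP0, ← hP1] at dp
    rw [da, dp]
    -- multiply the claim by `ρ₁ D > 0`
    have key : ρ₁ * D * (((1 - (r₂ : ℝ)) * X10 + (r₂ : ℝ) * X11) - ((1 - (r₂ : ℝ)) * P0 + (r₂ : ℝ) * P1)) =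
        α₁ - θ * β₁ := by
      have : ρ₁ * D * (((1 - (r₂ : ℝ)) * X10 + (r₂ : ℝ) * X11) - ((1 - (r₂ : ℝ)) * P0 + (r₂ : ℝ) * P1)) =
          ρ₁ * ((1 - (r₂ : ℝ)) * D) * (X10 - P0) - ρ₁ * ((r₂ : ℝ) * D) * (P1 - X11) := by ring
      rw [this, hrD, h1rD, hα₁, hβ₁]; ring
    have hneg : ρ₁ * D * (((1 - (r₂ : ℝ)) * X10 + (r₂ : ℝ) * X11) - ((1 - (r₂ : ℝ)) * P0 + (r₂ : ℝ) * P1)) ≤ 0 := by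
      rw [key]; linarith
    by_contra hcon
    push Not at hcon
    have : 0 < ρ₁ * D * (((1 - (r₂ : ℝ)) * X10 + (r₂ : ℝ) * X11) - ((1 - (r₂ : ℝ)) * P0 + (r₂ : ℝ) * P1)) :=
      mul_pos (mul_pos hpos₁ hDpos) (by linarith)
    linarith
  · -- anchor `p₂`: `e₂` forced open, `e₁` re-weighted to odds `(1−θ)·odds(ρ₁)`
    intro r₁ hr₁
    obtain ⟨D, hD⟩ : ∃ t : ℝ, t = 1 - ρ₁ + ρ₁ * (1 - θ) := ⟨_, rfl⟩
    have hDpos : 0 < D := by rw [hD]; nlinarith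
    have hrD : (r₁ : ℝ) * D = ρ₁ * (1 - θ) := by
      rw [hr₁, ← hD]; field_simp
    have h1rD : (1 - (r₁ : ℝ)) * D = 1 - ρ₁ := by
      have : (1 - (r₁ : ℝ)) * D = D - (r₁ : ℝ) * D := by ring
      rw [this, hrD, hD]; ring
    have hW' : ∀ t : unitInterval, Function.update (Function.update w e₂ 1) e₁ t =
        Function.update (Function.update w e₁ t) e₂ 1 := fun t => (Function.update_comm hne t 1 w).symm
    have da := stub_oneBondDecomp_k15 n (Function.update (Function.update w e₂ 1) e₁ r₁) e₁ (openConn a b)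
    have dp := stub_oneBondDecomp_k15 n (Function.update (Function.update w e₂ 1) e₁ r₁) e₁ (openConn p₂ b)
    rw [Function.update_self, Function.update_idem, Function.update_idem, hW' 0, hW' 1] at da dp
    rw [← hX01, ← hX11] at da
    rw [← hQ0, ← hQ1] at dp
    rw [da, dp]
    have key : ρ₂ * D * (((1 - (r₁ : ℝ)) * X01 + (r₁ : ℝ) * X11) - ((1 - (r₁ : ℝ)) * Q0 + (r₁ : ℝ) * Q1)) =
        α₂ - (1 - θ) * β₂ := by
      have : ρ₂ * D * (((1 - (r₁ : ℝ)) * X01 + (r₁ : ℝ) * X11) - ((1 - (r₁ : ℝ)) * Q0 + (r₁ : ℝ) * Q1)) =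
          ρ₂ * ((1 - (r₁ : ℝ)) * D) * (X01 - Q0) - ρ₂ * ((r₁ : ℝ) * D) * (Q1 - X11) := by ring
      rw [this, hrD, h1rD, hα₂, hβ₂]; ring
    have hneg : ρ₂ * D * (((1 - (r₁ : ℝ)) * X01 + (r₁ : ℝ) * X11) - ((1 - (r₁ : ℝ)) * Q0 + (r₁ : ℝ) * Q1)) ≤ 0 := by
      rw [key]; linarith
    by_contra hcon
    push Not at hcon
    have : 0 < ρ₂ * D * (((1 - (r₁ : ℝ)) * X01 + (r₁ : ℝ) * X11) - ((1 - (r₁ : ℝ)) * Q0 + (r₁ : ℝ) * Q1)) :=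
      mul_pos (mul_pos hpos₂ hDpos) (by linarith)
    linarith

end BlockQ9

end

end Summit.CriticalPhenomena.PercolationContinuityZ3.Theorems
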